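import Literature.RepresentationTheory.Virasoro.HighestWeightModule
import Mathlib.Algebra.MvPolynomial.Eval

/-!
# The universal family of Verma modules: structure constants are polynomials in `(c, h)`

Iohara–Koga eq. (4.18): in the Verma module `V(c,h) = M(c,h)`, for `j > 0` and `𝕀 ⊢ n`,
`L_j e_𝕀 v_{c,h} = Σ_{𝕀' ⊢ n-j} c_{𝕀'} e_{𝕀'} v_{c,h}` with `c_{𝕀'} ∈ ℂ[c, h]` — the coefficients
obtained by commuting `L_j` to the right through the word are POLYNOMIALS in the central charge and
the highest weight, the SAME polynomials in every `V(c,h)`. This uniformity is what the proof of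
Iohara–Koga Proposition 5.2 uses ("the condition (5.31) is equivalent to a system of linear equations
defined over the coordinate ring"). We prove it (`exists_strConst`, `L_partitionVector_eq_sum_strConst`)
without constructing a Verma module over `ℂ[c,h]`: the PRODUCT `Π_{(c,h) ∈ ℂ²} V(c,h)` of all the
Verma modules of `Literature.RepresentationTheory.Virasoro.VermaModule` is a module over the polynomial
ring `ℂ[C, H]` (acting on the `(c,h)`-component through evaluation, `moduleCH`, a LOCAL instance) on
which the componentwise `L_n` form a representation of the Virasoro algebra OVER `ℂ[C, H]` with central
charge `C`, generated over its highest-weight family `(v_{c,h})` on which `L_0` acts by `H`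
(`famRep`, `famL_zero_famHw`); straightening OVER THE RING `ℂ[C, H]` then expresses
`L_k (e_𝕀 v_{c,h})_{(c,h)}` in the `ℂ[C,H]`-span of the `(e_𝕁 v_{c,h})_{(c,h)}`, and evaluating at a
point gives the uniform structure constants.

* `RingVirasoroRep A c V` — a representation of the Virasoro algebra over a commutative `ℂ`-algebra
  `A` with central charge `c ∈ A` (`VirasoroRep` is the case `A = ℂ`), with its words `pbwVector`,
  PBW monomials `partitionVector`, level spaces `levelSpace` (the `A`-span) and the straightening
  theorems `L_neg_mem_levelSpace` (negative modes; the proof of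
  `VirasoroRep.L_neg_mem_levelSpace` verbatim over `A`) and `L_pos_pbwVector_mem` (positive modes
  on a vector with `L_0 w = h w`, `L_n w = 0`, `n > 0`).
  -- TODO(general form): `VirasoroRep` and `HighestWeightModule` should themselves be stated over a
  -- commutative base ring, which would make the `A = ℂ` duplicates unnecessary.
* `famRep : RingVirasoroRep ℂ[C,H] C (Π V(c,h))`, `famHw`, `famL_pos_famHw`, `famL_zero_famHw`,
  `famRep_partitionVector_apply`.
* **`exists_strConst` / `strConst` / `L_partitionVector_eq_sum_strConst`**: for `k ≥ 1`, `𝕀 ⊢ N`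
  there are `C^{(k)}_{𝕀,𝕁} ∈ ℂ[C,H]`, `𝕁 ⊢ N - k`, with
  `L_k (e_𝕀 v_{c,h}) = Σ_𝕁 C^{(k)}_{𝕀,𝕁}(c,h) e_𝕁 v_{c,h}` in every `V(c,h)`.

## References

* [IoharaKoga2011] K. Iohara, Y. Koga, *Representation theory of the Virasoro algebra*, Springer 2011,
  eq. (4.18) and Proposition 5.2 (proof).
-/

noncomputable section

namespace Literature.RepresentationTheory.Virasoro

/-! ### Representations of the Virasoro algebra over a commutative `ℂ`-algebra -/

/-- The central term `(1/12)(m³ - m) c δ_{m+n,0}` with `c` in a commutative `ℂ`-algebra `A`.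
[cite: IoharaKoga2011, Definition 1.2] -/
def ringCentralTerm {A : Type*} [CommRing A] [Algebra ℂ A] (c : A) (m n : ℤ) : A :=
  if m + n = 0 then algebraMap ℂ A 12⁻¹ * c * ((m : A) ^ 3 - m) else 0

/-- `L_0` has no central term with anybody. [folklore] -/
@[simp] theorem ringCentralTerm_zero_left {A : Type*} [CommRing A] [Algebra ℂ A] (c : A) (n : ℤ) :
    ringCentralTerm c 0 n = 0 := by
  simp [ringCentralTerm]

/-- Off the anti-diagonal the central term vanishes. [folklore] -/
theorem ringCentralTerm_of_ne {A : Type*} [CommRing A] [Algebra ℂ A] (c : A) {m n : ℤ} (h : m + n ≠ 0) :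
    ringCentralTerm c m n = 0 := if_neg h

/-- A **representation of the Virasoro algebra over a commutative `ℂ`-algebra `A`** with central
charge `c ∈ A`: `A`-linear endomorphisms `L_n` with
`L_m L_n x - L_n L_m x = (m - n) L_{m+n} x + (1/12)(m³ - m) c δ_{m+n,0} x`.
(`Literature.RepresentationTheory.Virasoro.VirasoroRep` is the case `A = ℂ`; the general base ring
is needed for families of modules depending polynomially on parameters.)
-- TODO(general form): `VirasoroRep` itself should be generalised over a commutative ring.
[cite: IoharaKoga2011, Definition 1.2 and §5.2.2 (U(𝔤⁻) ⊗ ℂ[𝒱] — families over a coordinate ring)] -/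
structure RingVirasoroRep (A : Type*) [CommRing A] [Algebra ℂ A] (c : A) (V : Type*) [AddCommGroup V]
    [Module A V] where
  /-- The Virasoro generators `L_n`, `n ∈ ℤ`, as `A`-linear endomorphisms of `V`. -/
  L : ℤ → V →ₗ[A] V
  /-- The commutation relations. -/
  lie : ∀ (m n : ℤ) (x : V),
    L m (L n x) - L n (L m x) = ((m : A) - n) • L (m + n) x + ringCentralTerm c m n • x

namespace RingVirasoroRep

variable {A : Type*} [CommRing A] [Algebra ℂ A] {c : A} {V : Type*} [AddCommGroup V] [Module A V]
  (R : RingVirasoroRep A c V)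

/-- The relation solved for `L_m L_n x`. [cite: IoharaKoga2011, Definition 1.2] -/
theorem comm_apply (m n : ℤ) (x : V) :
    R.L m (R.L n x) = R.L n (R.L m x) + ((m : A) - n) • R.L (m + n) x + ringCentralTerm c m n • x := by
  have := R.lie m n x
  rw [sub_eq_iff_eq_add] at this
  rw [this]; abel

/-- The descendant `L_{-k₁} ⋯ L_{-k_j} v` along a word. [cite: IoharaKoga2011, eq. (4.17)] -/
def pbwVector (l : List ℕ) (v : V) : V :=
  l.foldr (fun k w => R.L (-(k : ℤ)) w) v

/-- Unfolding on the empty word. [folklore] -/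
@[simp] theorem pbwVector_nil (v : V) : R.pbwVector [] v = v := rfl

/-- Unfolding on a non-empty word. [folklore] -/
@[simp] theorem pbwVector_cons (k : ℕ) (l : List ℕ) (v : V) :
    R.pbwVector (k :: l) v = R.L (-(k : ℤ)) (R.pbwVector l v) := rfl

/-- The PBW monomial of a partition (parts in decreasing order). [cite: IoharaKoga2011, eq. (4.17)] -/
def partitionVector {N : ℕ} (p : N.Partition) (v : V) : V :=
  R.pbwVector (p.parts.sort (· ≤ ·)).reverse v

/-- The level-`N` descendant space: the `A`-span of the ordered PBW monomials of level `N`.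
[cite: IoharaKoga2011, §4.4.2] -/
def levelSpace (w : V) (N : ℕ) : Submodule A V :=
  Submodule.span A (Set.range fun p : Nat.Partition N => R.partitionVector p w)

/-- `e_𝕀 w ∈ levelSpace w N`. [folklore] -/
theorem partitionVector_mem_levelSpace (w : V) {N : ℕ} (p : Nat.Partition N) :
    R.partitionVector p w ∈ R.levelSpace w N :=
  Submodule.subset_span ⟨p, rfl⟩

/-- The word of a partition is decreasing, positive, of sum `N`. [folklore] -/
theorem exists_list_of_partition (w : V) {N : ℕ} (p : Nat.Partition N) :
    ∃ l : List ℕ, l.Pairwise (· ≥ ·) ∧ (∀ j ∈ l, 0 < j) ∧ l.sum = N ∧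
      R.partitionVector p w = R.pbwVector l w := by
  refine ⟨(p.parts.sort (· ≤ ·)).reverse, ?_, ?_, ?_, rfl⟩
  · exact List.pairwise_reverse.mpr (Multiset.pairwise_sort p.parts (· ≤ ·))
  · intro j hj
    rw [List.mem_reverse, Multiset.mem_sort] at hj
    exact p.parts_pos hj
  · rw [List.sum_reverse, ← Multiset.sum_coe, Multiset.sort_eq, p.parts_sum]

/-- A decreasing positive word is the word of a partition. [folklore] -/
theorem pbwVector_mem_levelSpace (w : V) {l : List ℕ} (hs : l.Pairwise (· ≥ ·))
    (hp : ∀ j ∈ l, 0 < j) : R.pbwVector l w ∈ R.levelSpace w l.sum := by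
  let p : Nat.Partition l.sum :=
    ⟨(l : Multiset ℕ), fun hi => hp _ (Multiset.mem_coe.mp hi), Multiset.sum_coe l⟩
  have hsort : p.parts.sort (· ≤ ·) = l.reverse := by
    refine List.Perm.eq_of_pairwise' (r := (· ≤ ·)) (Multiset.pairwise_sort p.parts (· ≤ ·))
      (List.pairwise_reverse.mpr hs) ?_
    exact Multiset.coe_eq_coe.mp ((Multiset.sort_eq _ _).trans (Multiset.coe_reverse l).symm)
  have h1 := R.partitionVector_mem_levelSpace w p
  rwa [partitionVector, hsort, List.reverse_reverse] at h1

/-- **Straightening over `A`** (negative modes): `L_{-k}` maps `levelSpace w N` into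
`levelSpace w (N + k)`. [cite: IoharaKoga2011, §4.4.2] -/
theorem L_neg_mem_levelSpace (w : V) (N : ℕ) :
    ∀ (k : ℕ), 0 < k → ∀ x ∈ R.levelSpace w N, R.L (-(k : ℤ)) x ∈ R.levelSpace w (N + k) := by
  induction N using Nat.strong_induction_on with
  | _ N ih =>
  intro k hk x hx
  induction hx using Submodule.span_induction with
  | mem x hx =>
    obtain ⟨p, rfl⟩ := hx
    obtain ⟨l, hs, hpos, hsum, hl⟩ := R.exists_list_of_partition w p
    dsimp only
    rw [hl]
    subst hsum
    cases l with
    | nil =>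
      have h1 := R.pbwVector_mem_levelSpace w (l := [k]) (List.pairwise_singleton _ _)
        (by simpa using hk)
      simpa using h1
    | cons a l =>
      rw [List.pairwise_cons] at hs
      by_cases hka : a ≤ k
      · have hs' : (k :: a :: l).Pairwise (· ≥ ·) := by
          refine List.pairwise_cons.mpr ⟨fun b hb => ?_, List.pairwise_cons.mpr hs⟩
          rcases List.mem_cons.mp hb with rfl | hb
          · exact hka
          · exact (hs.1 b hb).trans hka
        have hpos' : ∀ j ∈ k :: a :: l, 0 < j := by
          intro j hj
          rcases List.mem_cons.mp hj with rfl | hj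
          · exact hk
          · exact hpos j hj
        have h1 := R.pbwVector_mem_levelSpace w hs' hpos'
        rw [pbwVector_cons] at h1
        have e : (k :: a :: l).sum = (a :: l).sum + k := by simp [List.sum_cons]; omega
        rwa [e] at h1
      · have hka' : k < a := Nat.lt_of_not_le hka
        have ha : 0 < a := hpos a List.mem_cons_self
        set y := R.pbwVector l w with hy_def
        have hy : y ∈ R.levelSpace w l.sum :=
          R.pbwVector_mem_levelSpace w hs.2 fun j hj => hpos j (List.mem_cons_of_mem a hj)
        have hlt : l.sum < (a :: l).sum := by rw [List.sum_cons]; omega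
        have h1 : R.L (-(k : ℤ)) y ∈ R.levelSpace w (l.sum + k) := ih _ hlt k hk y hy
        have hlt' : l.sum + k < (a :: l).sum := by rw [List.sum_cons]; omega
        have h2 : R.L (-(a : ℤ)) (R.L (-(k : ℤ)) y) ∈ R.levelSpace w (l.sum + k + a) :=
          ih _ hlt' a ha _ h1
        have h3 : R.L (-((k + a : ℕ) : ℤ)) y ∈ R.levelSpace w (l.sum + (k + a)) :=
          ih _ hlt (k + a) (by omega) y hy
        rw [pbwVector_cons, R.comm_apply (-(k : ℤ)) (-(a : ℤ)) y,
          ringCentralTerm_of_ne c (by omega : -(k : ℤ) + -(a : ℤ) ≠ 0), zero_smul, add_zero]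
        have e1 : l.sum + k + a = (a :: l).sum + k := by rw [List.sum_cons]; omega
        have e2 : l.sum + (k + a) = (a :: l).sum + k := by rw [List.sum_cons]; omega
        have e3 : -(k : ℤ) + -(a : ℤ) = -((k + a : ℕ) : ℤ) := by push_cast; ring
        rw [e1] at h2
        rw [e2] at h3
        rw [e3]
        exact add_mem h2 (Submodule.smul_mem _ _ h3)
  | zero => rw [map_zero]; exact zero_mem _
  | add x y _ _ hx hy => rw [map_add]; exact add_mem hx hy
  | smul a x _ hx => rw [map_smul]; exact Submodule.smul_mem _ a hx

/-- `L_0` on a word over a vector with `L_0 w = h w`: `L_0 (e_l w) = (h + |l|) e_l w`. [folklore] -/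
theorem L_zero_pbwVector {w : V} {h : A} (hw : R.L 0 w = h • w) (l : List ℕ) :
    R.L 0 (R.pbwVector l w) = (h + (l.sum : ℕ)) • R.pbwVector l w := by
  induction l with
  | nil => simpa using hw
  | cons k l ih =>
    rw [pbwVector_cons, R.comm_apply 0 (-(k : ℤ)), ih, map_smul, zero_add, ringCentralTerm_zero_left, zero_smul,
      add_zero, ← add_smul, List.sum_cons]
    congr 1
    push_cast
    ring

/-- **Straightening over `A`** (positive modes): for `w` with `L_0 w = h w` and `L_n w = 0` (`n > 0`),
and a decreasing positive word `l`, `L_k (e_l w)` (`k ≥ 1`) lies in `levelSpace w (|l| - k)` if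
`k ≤ |l|` and vanishes if `k > |l|` (commute `L_k` to the right through the word).
[cite: IoharaKoga2011, eq. (4.18) (L_j.e_𝕀 v_{c,h} = Σ c_{𝕀'} e_{𝕀'} v_{c,h} with c_{𝕀'} ∈ ℂ[c,h])] -/
theorem L_pos_pbwVector_mem {w : V} {h : A} (hw0 : R.L 0 w = h • w) (hwpos : ∀ n : ℤ, 0 < n → R.L n w = 0) :
    ∀ (l : List ℕ), l.Pairwise (· ≥ ·) → (∀ j ∈ l, 0 < j) → ∀ (k : ℕ), 0 < k →
      (k ≤ l.sum → R.L k (R.pbwVector l w) ∈ R.levelSpace w (l.sum - k)) ∧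
        (l.sum < k → R.L k (R.pbwVector l w) = 0) := by
  intro l
  induction l with
  | nil =>
    intro _ _ k hk
    refine ⟨fun h => by simp at h; omega, fun _ => ?_⟩
    rw [pbwVector_nil]
    exact hwpos k (by exact_mod_cast hk)
  | cons a l ih =>
    intro hs hpos k hk
    rw [List.pairwise_cons] at hs
    have ha : 0 < a := hpos a List.mem_cons_self
    have hpos' : ∀ j ∈ l, 0 < j := fun j hj => hpos j (List.mem_cons_of_mem a hj)
    have ih' := ih hs.2 hpos'
    set y := R.pbwVector l w with hy_def
    have hy : y ∈ R.levelSpace w l.sum := R.pbwVector_mem_levelSpace w hs.2 hpos'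
    have hS : (a :: l).sum = a + l.sum := List.sum_cons
    -- `L_k L_{-a} y = L_{-a} L_k y + (k + a) L_{k-a} y + central · y`
    have hcomm : R.L k (R.pbwVector (a :: l) w) =
        R.L (-(a : ℤ)) (R.L k y) + ((k : A) + a) • R.L ((k : ℤ) - a) y + ringCentralTerm c k (-(a : ℤ)) • y := by
      rw [pbwVector_cons, R.comm_apply (k : ℤ) (-(a : ℤ)) y, ← sub_eq_add_neg]
      congr 2
      push_cast
      ring
    -- the middle term
    have hmid : (k ≤ a + l.sum → R.L ((k : ℤ) - a) y ∈ R.levelSpace w (a + l.sum - k)) ∧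
        (a + l.sum < k → R.L ((k : ℤ) - a) y = 0) := by
      rcases lt_trichotomy k a with hka | rfl | hka
      · rw [show (k : ℤ) - a = -((a - k : ℕ) : ℤ) by omega]
        refine ⟨fun _ => ?_, fun h => by omega⟩
        have := R.L_neg_mem_levelSpace w l.sum (a - k) (by omega) y hy
        rwa [show l.sum + (a - k) = a + l.sum - k by omega] at this
      · rw [sub_self, Nat.add_sub_cancel_left]
        refine ⟨fun _ => ?_, fun h => by omega⟩
        rw [R.L_zero_pbwVector hw0 l]
        exact Submodule.smul_mem _ _ hy
      · rw [show (k : ℤ) - a = ((k - a : ℕ) : ℤ) by omega]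
        obtain ⟨h1, h2⟩ := ih' (k - a) (by omega)
        refine ⟨fun h => ?_, fun h => h2 (by omega)⟩
        have := h1 (by omega)
        rwa [show l.sum - (k - a) = a + l.sum - k by omega] at this
    -- the central term
    have hcen : ringCentralTerm c k (-(a : ℤ)) • y ∈ R.levelSpace w (a + l.sum - k) ∧
        (k ≠ a → ringCentralTerm c k (-(a : ℤ)) • y = 0) := by
      by_cases hka : k = a
      · subst hka
        rw [Nat.add_sub_cancel_left]
        exact ⟨Submodule.smul_mem _ _ hy, fun h => absurd rfl h⟩
      · rw [ringCentralTerm_of_ne c (by omega : (k : ℤ) + -(a : ℤ) ≠ 0), zero_smul]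
        exact ⟨zero_mem _, fun _ => rfl⟩
    rw [hcomm, hS]
    refine ⟨fun hkS => ?_, fun hSk => ?_⟩
    · refine add_mem (add_mem ?_ (Submodule.smul_mem _ _ (hmid.1 hkS))) hcen.1
      -- the first term
      by_cases hkl : k ≤ l.sum
      · have := R.L_neg_mem_levelSpace w (l.sum - k) a ha _ ((ih' k hk).1 hkl)
        rwa [show l.sum - k + a = a + l.sum - k by omega] at this
      · rw [(ih' k hk).2 (by omega), map_zero]
        exact zero_mem _
    · rw [(ih' k hk).2 (by omega), map_zero, zero_add, hmid.2 hSk, smul_zero, zero_add, hcen.2 (by omega)]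

/-- Positive modes on PBW monomials, partition form: `L_k (e_𝕀 w) ∈ levelSpace w (N - k)` for
`𝕀 ⊢ N`, `1 ≤ k ≤ N`. [cite: IoharaKoga2011, eq. (4.18)] -/
theorem L_pos_partitionVector_mem {w : V} {h : A} (hw0 : R.L 0 w = h • w)
    (hwpos : ∀ n : ℤ, 0 < n → R.L n w = 0) {N : ℕ} (p : Nat.Partition N) {k : ℕ} (hk : 0 < k)
    (hkN : k ≤ N) : R.L k (R.partitionVector p w) ∈ R.levelSpace w (N - k) := by
  obtain ⟨l, hs, hpos, hsum, hl⟩ := R.exists_list_of_partition w p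
  rw [hl]
  subst hsum
  exact (R.L_pos_pbwVector_mem hw0 hwpos l hs hpos k hk).1 hkN

/-- Positive modes above the level kill the PBW monomials: `L_k (e_𝕀 w) = 0` for `𝕀 ⊢ N < k`. [folklore] -/
theorem L_pos_partitionVector_eq_zero {w : V} {h : A} (hw0 : R.L 0 w = h • w)
    (hwpos : ∀ n : ℤ, 0 < n → R.L n w = 0) {N : ℕ} (p : Nat.Partition N) {k : ℕ} (hk : 0 < k)
    (hNk : N < k) : R.L k (R.partitionVector p w) = 0 := by
  obtain ⟨l, hs, hpos, hsum, hl⟩ := R.exists_list_of_partition w p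
  rw [hl]
  subst hsum
  exact (R.L_pos_pbwVector_mem hw0 hwpos l hs hpos k hk).2 hNk

end RingVirasoroRep

/-! ### Words in the family representation -/

namespace RingVirasoroRep

variable {A : Type*} [CommRing A] [Algebra ℂ A] {c : A} {V : Type*} [AddCommGroup V] [Module A V]
  (R : RingVirasoroRep A c V)

/-- Membership in a level space, in coordinates. [folklore] -/
theorem exists_coord_of_mem_levelSpace {w : V} {N : ℕ} {x : V} (hx : x ∈ R.levelSpace w N) :
    ∃ C : Nat.Partition N → A, ∑ p, C p • R.partitionVector p w = x :=
  (Submodule.mem_span_range_iff_exists_fun A).mp hx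

end RingVirasoroRep

/-! ### The universal family `Π_{(c,h)} V(c,h)` over `ℂ[C, H]` -/

section Family

open MvPolynomial

/-- The parameter ring `ℂ[C, H]` of central charges and conformal weights. [cite: IoharaKoga2011, §5.2.2 (ℂ[𝔥*] ≃ ℂ[c,h])] -/
abbrev CHRing : Type := MvPolynomial (Fin 2) ℂ

/-- Evaluation of `ℂ[C, H]` at a point `(c, h)`. [folklore] -/
abbrev evalCH (c h : ℂ) : CHRing →+* ℂ := MvPolynomial.eval ![c, h]

/-- `C(c, h) = c`. [folklore] -/
@[simp] theorem evalCH_X_zero (c h : ℂ) : evalCH c h (X 0) = c := by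
  rw [MvPolynomial.eval_X]; rfl

/-- `H(c, h) = h`. [folklore] -/
@[simp] theorem evalCH_X_one (c h : ℂ) : evalCH c h (X 1) = h := by
  rw [MvPolynomial.eval_X]; rfl

/-- The central term of the family specialises to the central term at `(c, h)`. [folklore] -/
theorem evalCH_ringCentralTerm (c h : ℂ) (m n : ℤ) :
    evalCH c h (ringCentralTerm (X 0 : CHRing) m n) = centralTerm c m n := by
  rw [ringCentralTerm, centralTerm]
  split_ifs with hmn
  · rw [map_mul, map_mul, MvPolynomial.algebraMap_eq, MvPolynomial.eval_C, evalCH_X_zero, map_sub, map_pow,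
      map_intCast]
    ring
  · rw [map_zero]

/-- `ℂ[C, H]` acts on `V(c, h)` through the evaluation at `(c, h)`. [folklore] -/
@[reducible] def moduleCH (q : ℂ × ℂ) : Module CHRing (Verma q.1 q.2) :=
  Module.compHom (Verma q.1 q.2) (evalCH q.1 q.2)

attribute [local instance] moduleCH

/-- **The universal family**: the product `Π_{(c,h) ∈ ℂ²} V(c,h)` of all Verma modules, a module over
`ℂ[C, H]` (acting on the `(c,h)`-component through evaluation). [cite: IoharaKoga2011, §5.2.2 (the family S_n(c,h).v_{c,h}, (c,h) ∈ 𝒱, with coefficients in the coordinate ring)] -/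
abbrev VermaPi : Type := ∀ q : ℂ × ℂ, Verma q.1 q.2

/-- The action of `ℂ[C, H]` on the family is evaluation followed by the scalar action. [folklore] -/
theorem smul_apply_pi (f : CHRing) (x : VermaPi) (q : ℂ × ℂ) : (f • x) q = (evalCH q.1 q.2 f) • x q := rfl

/-- The Virasoro generators act componentwise on the family, `ℂ[C, H]`-linearly. [folklore] -/
def famL (k : ℤ) : VermaPi →ₗ[CHRing] VermaPi where
  toFun x q := (Verma.rep q.1 q.2).L k (x q)
  map_add' x y := funext fun q => by
    show (Verma.rep q.1 q.2).L k (x q + y q) = _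
    rw [map_add]; rfl
  map_smul' f x := funext fun q => by
    show (Verma.rep q.1 q.2).L k ((evalCH q.1 q.2 f) • x q) = (evalCH q.1 q.2 f) • (Verma.rep q.1 q.2).L k (x q)
    rw [map_smul]

/-- Unfolding of the componentwise action. [folklore] -/
@[simp] theorem famL_apply (k : ℤ) (x : VermaPi) (q : ℂ × ℂ) : famL k x q = (Verma.rep q.1 q.2).L k (x q) := rfl

/-- **The universal family is a representation over `ℂ[C, H]` with central charge `C`.**
[cite: IoharaKoga2011, §5.2.2] -/
def famRep : RingVirasoroRep CHRing (X 0 : CHRing) VermaPi where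
  L := famL
  lie m n x := funext fun q => by
    show (Verma.rep q.1 q.2).L m ((Verma.rep q.1 q.2).L n (x q)) - (Verma.rep q.1 q.2).L n ((Verma.rep q.1 q.2).L m (x q)) =
      (evalCH q.1 q.2 ((m : CHRing) - n)) • (Verma.rep q.1 q.2).L (m + n) (x q) +
        (evalCH q.1 q.2 (ringCentralTerm (X 0 : CHRing) m n)) • x q
    rw [(Verma.rep q.1 q.2).lie m n (x q), map_sub, map_intCast, map_intCast, evalCH_ringCentralTerm]

/-- The family of highest-weight vectors `(v_{c,h})_{(c,h)}`. [folklore] -/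
def famHw : VermaPi := fun q => Verma.hw q.1 q.2

/-- `L_n` (`n > 0`) kills the family of highest-weight vectors. [folklore] -/
theorem famL_pos_famHw (n : ℤ) (hn : 0 < n) : famRep.L n famHw = 0 :=
  funext fun q => (Verma.isPrimary_hw (c := q.1) (h := q.2)).annihilated n hn

/-- `L_0` acts on the family of highest-weight vectors by `H`. [folklore] -/
theorem famL_zero_famHw : famRep.L 0 famHw = (X 1 : CHRing) • famHw :=
  funext fun q => by
    rw [smul_apply_pi, evalCH_X_one]
    exact (Verma.isPrimary_hw (c := q.1) (h := q.2)).weight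

/-- Words in the family are the families of words. [folklore] -/
theorem famRep_pbwVector_apply (l : List ℕ) (x : VermaPi) (q : ℂ × ℂ) :
    famRep.pbwVector l x q = (Verma.rep q.1 q.2).pbwVector l (x q) := by
  induction l with
  | nil => rfl
  | cons k l ih =>
    rw [RingVirasoroRep.pbwVector_cons, VirasoroRep.pbwVector_cons, ← ih]
    rfl

/-- PBW monomials in the family are the families of PBW monomials. [folklore] -/
theorem famRep_partitionVector_apply {N : ℕ} (p : Nat.Partition N) (q : ℂ × ℂ) :
    famRep.partitionVector p famHw q = (Verma.rep q.1 q.2).partitionVector p (Verma.hw q.1 q.2) :=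
  famRep_pbwVector_apply _ _ q

/-- **The structure constants of Verma modules are polynomials in `(c, h)`**: for `k ≥ 1` and
`𝕀 ⊢ N` there are `C_{𝕀,𝕁} ∈ ℂ[C, H]` (`𝕁 ⊢ N - k`) with
`L_k (e_𝕀 v_{c,h}) = Σ_𝕁 C_{𝕀,𝕁}(c, h) e_𝕁 v_{c,h}` in EVERY Verma module `V(c,h)` (for `k > N` one
may take `C = 0`). [cite: IoharaKoga2011, eq. (4.18) ("c_{𝕀'} ∈ ℂ[c,h]") and Proposition 5.2 (proof: the system (5.31) is defined over the coordinate ring)] -/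
theorem exists_strConst (k N : ℕ) (hk : 0 < k) (I : Nat.Partition N) :
    ∃ C : Nat.Partition (N - k) → CHRing, ∀ c h : ℂ,
      (Verma.rep c h).L k ((Verma.rep c h).partitionVector I (Verma.hw c h)) =
        ∑ J, evalCH c h (C J) • (Verma.rep c h).partitionVector J (Verma.hw c h) := by
  by_cases hkN : k ≤ N
  · have hmem := famRep.L_pos_partitionVector_mem (w := famHw) (h := (X 1 : CHRing)) famL_zero_famHw
      famL_pos_famHw I hk hkN
    obtain ⟨C, hC⟩ := famRep.exists_coord_of_mem_levelSpace hmem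
    refine ⟨C, fun c h => ?_⟩
    have h1 := congrFun hC (c, h)
    rw [Finset.sum_apply, show famRep.L (k : ℤ) = famL k from rfl, famL_apply, famRep_partitionVector_apply] at h1
    simp only [smul_apply_pi, famRep_partitionVector_apply] at h1
    exact h1.symm
  · refine ⟨fun _ => 0, fun c h => ?_⟩
    have h0 := congrFun (famRep.L_pos_partitionVector_eq_zero (w := famHw) (h := (X 1 : CHRing)) famL_zero_famHw
      famL_pos_famHw I hk (by omega)) (c, h)
    rw [show famRep.L (k : ℤ) = famL k from rfl, famL_apply, famRep_partitionVector_apply] at h0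
    simp only [map_zero]
    have hz : ∑ J : Nat.Partition (N - k), (0 : ℂ) • (Verma.rep c h).partitionVector J (Verma.hw c h) = 0 :=
      Finset.sum_eq_zero fun J _ => zero_smul ℂ ((Verma.rep c h).partitionVector J (Verma.hw c h))
    exact h0.trans hz.symm

/-- **The universal structure constants** `C^{(k)}_{𝕀,𝕁} ∈ ℂ[C, H]` of the Verma modules.
[cite: IoharaKoga2011, eq. (4.18)] -/
def strConst (k N : ℕ) (hk : 0 < k) (I : Nat.Partition N) (J : Nat.Partition (N - k)) : CHRing :=
  (exists_strConst k N hk I).choose J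

/-- The defining property of the universal structure constants, in every `V(c, h)`. [cite: IoharaKoga2011, eq. (4.18)] -/
theorem L_partitionVector_eq_sum_strConst (k N : ℕ) (hk : 0 < k) (I : Nat.Partition N) (c h : ℂ) :
    (Verma.rep c h).L k ((Verma.rep c h).partitionVector I (Verma.hw c h)) =
      ∑ J, evalCH c h (strConst k N hk I J) • (Verma.rep c h).partitionVector J (Verma.hw c h) :=
  (exists_strConst k N hk I).choose_spec c h

end Family

end Literature.RepresentationTheory.Virasoro

end
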